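import Mathlib
import HarnessLib
import Literature.Analysis.FluidPDE.TsaiSelfSimilarBounded
import Literature.Analysis.FluidPDE.AxisymNoSwirlVorticity
import Literature.Analysis.FluidPDE.VectorCalculusProofs

/-!
# Route `HalfSpaceWindowDoor`, crux `CirculationCarryingRigidity` (stmt-NavierStokesRegularity-25311) — line
# `rot_bernoulli`, I: the ROTATION-CORRECTED BERNOULLI FUNCTION of a rotated Leray profile and its exact identity

LEAD ns-hsw-p1 g11 (cell pub-ns-dss).  Census line of the open research stub `stub_layerExclusion ≡ HemisphereLiouvilleE3`
(W6): a NEW MECHANISM for the ROTATED SELF-SIMILAR stratum of the door class.  The profile `U`, pressure `P`, of a backwards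
rotated self-similar solution `u(x,t) = (−t)^{−1/2} R(αs) U(R(−αs)x/√(−t))`, `s = −log(−t)`, `R(θ) = e^{θJ}` (`J` skew),
solves `−νΔU + aU + a(y·∇)U + (U·∇)U + ∇P + α(JU − (Jy·∇)U) = 0`, `div U = 0` (Pineau–Vicol arXiv:2607.09619 (1.8), with
`ν = 1`, `a = ½`).  Pineau–Vicol, p. 4: «We are not aware of any scalar quantity (an `α`-dependent modification of [the
head pressure]) playing the role of the Bernoulli function, and which satisfies a maximum principle.  This is the central
obstruction.»  THIS FILE (any finite-dimensional inner product space `E`, any skew `J : E →L[ℝ] E`): the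
ROTATION-CORRECTED head pressure `Π_α := P + ½|U|² + a y·U − α (Jy)·U` satisfies
* `fderiv_rotHead_eq` — `∇Π_α = νΔU − (DU − DUᵀ)(U + a y − α Jy)` (rotated form of Tsai 1998 (5.2));
* `driftOp_rotHead_eq` — EXACTLY `ν ΔΠ_α − (U + a y − α Jy)·∇Π_α = (ν/2)|DU − DUᵀ|² + 2να tr(J ∘ DU)`; on `ℝ³` with
  `J = e₃ ×` (`rotGenL`), `tr(J ∘ DU) = −ω₃` (`traceCLM_rotGenL_comp_fderiv`), i.e. (`driftOp_rotHead_eq_R3`)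
  `−νΔΠ_α + (U + a y − αJy)·∇Π_α = −ν(|Ω|² − 2αΩ₃)`: the defect of the maximum principle is EXACTLY `2αΩ₃`;
* `driftOp_rotHead_nonneg(_R3)` — so `Π_α` is a subsolution of Tsai's drift–Laplace operator wherever `α·tr(J∘DU) ≥ 0`,
  on `ℝ³`: `ω₃ ≥ 0` (closed hemisphere) and `α ≤ 0` (the profile COUNTER-ROTATES w.r.t. its vertical vorticity);
* `spin_eq_zero_and_laplacian_eq_zero_of_rotHead_const` — if moreover `Π_α` is constant then `DU` is symmetric and
  `ΔU ≡ 0`; and the pressure Poisson equation `ΔP = −tr(DU∘DU)` of the rotated system (`laplacian_pressure_eq_rot`).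
Sequel (`…RotHeadLiouville`): Tsai's Lemma 5.1 makes `Π_α` constant for bounded profiles ⇒ census row «closed-hemisphere
door-class profiles that are rotated self-similar with `α ≤ 0` are trivial» (`α = 0` = Tsai, in tree).

WHAT THIS IS NOT: not a statement about Navier–Stokes regularity (Clay A); the door statements concern HYPOTHETICAL blow-up
profiles (KNSS ancient mild solutions); helper `--supports` 25311; the item stays OPEN at its research stub.  Elementary
multivariable calculus on top of the tree's Tsai 1998 files (`TsaiProfileEndgame`, `LerayProfileCalculus`).
-/

noncomputable section

-- the summit and its single sub-problem share the name (CONVENTIONS §1), as in every Theorems file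
set_option linter.dupNamespace false

namespace Summit.NavierStokesRegularity.NavierStokesRegularity.Theorems.HalfSpaceWindowDoorCirculationCarryingRigidityRotHead

open Set Function Filter Topology InnerProductSpace
open scoped RealInnerProductSpace Laplacian ContDiff
open Literature.Analysis Literature.Analysis.FluidPDE

variable {E : Type*} [NormedAddCommGroup E] [InnerProductSpace ℝ E] [FiniteDimensional ℝ E]

/-! ### Linear algebra: traces against a skew map -/

/-- `tr (A ∘ B) = tr (B ∘ A)` for continuous linear endomorphisms (through `traceCLM`). -/
theorem traceCLM_comp_comm (A B : E →L[ℝ] E) : traceCLM (A.comp B) = traceCLM (B.comp A) := by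
  rw [traceCLM_apply, traceCLM_apply]
  change LinearMap.trace ℝ E ((A : E →ₗ[ℝ] E) ∘ₗ (B : E →ₗ[ℝ] E)) =
    LinearMap.trace ℝ E ((B : E →ₗ[ℝ] E) ∘ₗ (A : E →ₗ[ℝ] E))
  exact LinearMap.trace_comp_comm' (B : E →ₗ[ℝ] E) (A : E →ₗ[ℝ] E)

/-- For a skew `J` (`⟪J v, w⟫ = −⟪v, J w⟫`) and any `L`: `∑ᵢ ⟪J bᵢ, L bᵢ⟫ = −tr (J ∘ L)` (any orthonormal basis). -/
theorem sum_inner_skew_apply_eq_neg_traceCLM {ι : Type*} [Fintype ι] (b : OrthonormalBasis ι ℝ E)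
    {J : E →L[ℝ] E} (hJ : ∀ v w, ⟪J v, w⟫ = -⟪v, J w⟫) (L : E →L[ℝ] E) :
    ∑ i, ⟪J (b i), L (b i)⟫ = -traceCLM (J.comp L) := by
  rw [traceCLM_eq_sum_inner b, ← Finset.sum_neg_distrib]
  refine Finset.sum_congr rfl fun i _ => ?_
  rw [ContinuousLinearMap.comp_apply]
  exact hJ _ _

/-! ### Calculus of the correction term `y ↦ ⟪J y, U y⟫` -/

omit [FiniteDimensional ℝ E] in
/-- The derivative of the angular-momentum density: `D⟪J·, U⟫(y) v = ⟪J y, DU(y) v⟫ + ⟪J v, U(y)⟫`. -/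
theorem fderiv_inner_clm_apply (J : E →L[ℝ] E) {U : E → E} {y : E} (hU : DifferentiableAt ℝ U y) (v : E) :
    fderiv ℝ (fun z => ⟪J z, U z⟫) y v = ⟪J y, fderiv ℝ U y v⟫ + ⟪J v, U y⟫ := by
  rw [fderiv_inner_apply ℝ J.differentiableAt hU v, ContinuousLinearMap.fderiv]

/-- The Laplacian of a continuous linear map vanishes. -/
theorem laplacian_clm_eq_zero (J : E →L[ℝ] E) (x : E) : (Δ fun y => J y) x = 0 := by
  have h := ContDiffAt.laplacian_CLM_comp_left (l := J) (f := fun y : E => y) (x := x)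
    contDiff_id.contDiffAt
  have e : (⇑J ∘ fun y : E => y) = fun y => J y := rfl
  rw [e] at h
  rw [h, Function.comp_apply, laplacian_id_eq_zero, map_zero]

/-- The Laplacian of the angular-momentum density, `J` skew: `Δ⟪J·, U⟫(x) = ⟪J x, ΔU(x)⟫ − 2 tr(J ∘ DU(x))`. -/
theorem laplacian_inner_clm_eq {J : E →L[ℝ] E} (hJ : ∀ v w, ⟪J v, w⟫ = -⟪v, J w⟫) {U : E → E}
    (hU : ContDiff ℝ 2 U) (x : E) :
    (Δ fun y => ⟪J y, U y⟫) x = ⟪J x, (Δ U) x⟫ - 2 * traceCLM (J.comp (fderiv ℝ U x)) := by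
  set b := stdOrthonormalBasis ℝ E
  have hJ2 : ContDiff ℝ 2 fun y : E => J y := J.contDiff
  rw [laplacian_inner_eq b hJ2 hU x, laplacian_clm_eq_zero, inner_zero_left, zero_add]
  have hsum : ∑ i, ⟪fderiv ℝ (fun y : E => J y) x (b i), fderiv ℝ U x (b i)⟫ =
      ∑ i, ⟪J (b i), fderiv ℝ U x (b i)⟫ := by
    refine Finset.sum_congr rfl fun i _ => ?_
    rw [show (fun y : E => J y) = ⇑J from rfl, ContinuousLinearMap.fderiv]
  rw [hsum, sum_inner_skew_apply_eq_neg_traceCLM b hJ]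
  ring

/-! ### The rotation terms are divergence free; the pressure Poisson equation -/

omit [FiniteDimensional ℝ E] in
/-- `div (J ∘ U) = tr (J ∘ DU)`. -/
theorem divergence_clm_comp [FiniteDimensional ℝ E] (J : E →L[ℝ] E) {U : E → E} {x : E}
    (hU : DifferentiableAt ℝ U x) :
    VectorCalculus.divergence (fun y => J (U y)) x = traceCLM (J.comp (fderiv ℝ U x)) := by
  rw [divergence_eq_traceCLM]
  congr 1
  exact (J.hasFDerivAt.comp x hU.hasFDerivAt).fderiv

/-- `div (y ↦ DU(y)(J y)) = tr (DU ∘ J)` for a divergence-free `C²` field (`D(div U)(J y) = 0` by Schwarz). -/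
theorem divergence_fderiv_apply_clm {J : E →L[ℝ] E} {U : E → E} (hU : ContDiff ℝ 2 U)
    (hdiv : VectorCalculus.IsDivFree U) (y : E) :
    VectorCalculus.divergence (fun x => fderiv ℝ U x (J x)) y = traceCLM ((fderiv ℝ U y).comp J) := by
  have hDUd : Differentiable ℝ (fderiv ℝ U) :=
    (hU.fderiv_right (m := 1) le_rfl).differentiable one_ne_zero
  have hdiv0 : VectorCalculus.divergence U = fun _ => (0 : ℝ) := funext hdiv
  rw [divergence_eq_traceCLM, fderiv_clm_apply (hDUd y) J.differentiableAt, map_add,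
    ContinuousLinearMap.fderiv]
  have hsymm : traceCLM ((fderiv ℝ (fderiv ℝ U) y).flip (J y)) =
      fderiv ℝ (VectorCalculus.divergence U) y (J y) := by
    rw [fderiv_divergence_apply hU]
    congr 1
    ext u
    simp only [ContinuousLinearMap.flip_apply]
    exact (hU.contDiffAt.isSymmSndFDerivAt (n := 2) (by simp)) u (J y)
  rw [hsymm, hdiv0]
  simp

/-- The rotation terms are divergence free: `div (J ∘ U − DU(·)(J·)) = tr(J∘DU) − tr(DU∘J) = 0`. -/
theorem divergence_rot_eq_zero {J : E →L[ℝ] E} {U : E → E} (hU : ContDiff ℝ 2 U)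
    (hdiv : VectorCalculus.IsDivFree U) (y : E) :
    VectorCalculus.divergence (fun x => J (U x) - fderiv ℝ U x (J x)) y = 0 := by
  have hU1 : ContDiff ℝ 1 U := hU.of_le one_le_two
  have hUd : Differentiable ℝ U := hU1.differentiable one_ne_zero
  have hDUd : Differentiable ℝ (fderiv ℝ U) :=
    (hU.fderiv_right (m := 1) le_rfl).differentiable one_ne_zero
  have hdA : DifferentiableAt ℝ (fun x => J (U x)) y := J.differentiableAt.comp y (hUd y)
  have hdB : DifferentiableAt ℝ (fun x => fderiv ℝ U x (J x)) y :=
    (hDUd y).clm_apply J.differentiableAt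
  rw [divergence_sub_apply hdA hdB, divergence_clm_comp J (hUd y), divergence_fderiv_apply_clm hU hdiv,
    traceCLM_comp_comm, sub_self]

/-- **The pressure Poisson equation of a rotated Leray profile**: `ΔP = −tr (DU ∘ DU)` (divergence of the profile
system: `div ΔU = div U = div (y·∇U) = 0`, `div((U·∇)U) = tr(DU∘DU)`, rotation terms divergence free; `U ∈ C³`). -/
theorem laplacian_pressure_eq_rot {ν a α : ℝ} {J : E →L[ℝ] E} {U : E → E} {P : E → ℝ}
    (hU3 : ContDiff ℝ 3 U) (hP2 : ContDiff ℝ 2 P) (hdiv : VectorCalculus.IsDivFree U)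
    (heq : ∀ y, -(ν • (Δ U) y) + a • U y + a • fderiv ℝ U y y + convect U U y + gradient P y +
      α • (J (U y) - fderiv ℝ U y (J y)) = 0) (y : E) :
    (Δ P) y = -traceCLM ((fderiv ℝ U y).comp (fderiv ℝ U y)) := by
  have hU2 : ContDiff ℝ 2 U := hU3.of_le (by norm_num)
  have hU1 : ContDiff ℝ 1 U := hU3.of_le (by norm_num)
  have hUd : Differentiable ℝ U := hU1.differentiable one_ne_zero
  have hDUd : Differentiable ℝ (fderiv ℝ U) :=
    (hU2.fderiv_right (m := 1) le_rfl).differentiable one_ne_zero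
  have hgradP : gradient P = fun x => ν • (Δ U) x - a • U x - a • fderiv ℝ U x x - convect U U x -
      α • (J (U x) - fderiv ℝ U x (J x)) := by
    funext x
    have hx := heq x
    rw [← sub_eq_zero, ← hx]
    abel
  rw [← divergence_gradient hP2 y, hgradP]
  have hdA : DifferentiableAt ℝ (fun x => ν • (Δ U) x) y :=
    ((differentiable_laplacian hU3) y).const_smul ν
  have hdB : DifferentiableAt ℝ (fun x => a • U x) y := (hUd y).const_smul a
  have hdC' : DifferentiableAt ℝ (fun x => fderiv ℝ U x x) y :=
    (hDUd y).clm_apply differentiableAt_fun_id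
  have hdC : DifferentiableAt ℝ (fun x => a • fderiv ℝ U x x) y := hdC'.const_smul a
  have hdD : DifferentiableAt ℝ (convect U U) y := (hDUd y).clm_apply (hUd y)
  have hdR' : DifferentiableAt ℝ (fun x => J (U x) - fderiv ℝ U x (J x)) y :=
    (J.differentiableAt.comp y (hUd y)).sub ((hDUd y).clm_apply J.differentiableAt)
  have hdR : DifferentiableAt ℝ (fun x => α • (J (U x) - fderiv ℝ U x (J x))) y := hdR'.const_smul α
  have hdAB : DifferentiableAt ℝ (fun x => ν • (Δ U) x - a • U x) y := hdA.sub hdB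
  have hdABC : DifferentiableAt ℝ (fun x => ν • (Δ U) x - a • U x - a • fderiv ℝ U x x) y :=
    hdAB.sub hdC
  have hdABCD : DifferentiableAt ℝ
      (fun x => ν • (Δ U) x - a • U x - a • fderiv ℝ U x x - convect U U x) y := hdABC.sub hdD
  rw [divergence_sub_apply hdABCD hdR, divergence_sub_apply hdABC hdD, divergence_sub_apply hdAB hdC,
    divergence_sub_apply hdA hdB, divergence_const_smul_apply ((differentiable_laplacian hU3) y),
    divergence_const_smul_apply (hUd y), divergence_const_smul_apply hdC',
    divergence_const_smul_apply hdR',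
    divergence_laplacian_eq_zero hU3 hdiv, hdiv y,
    divergence_fderiv_apply_self_eq_zero hU2 hdiv, divergence_convect_self_eq hU2 hdiv,
    divergence_rot_eq_zero hU2 hdiv]
  ring

/-! ### The rotation-corrected head pressure `Π_α = ½|U|² + P + a y·U − α (Jy)·U` -/

omit [FiniteDimensional ℝ E] in
/-- `Π_α` is `Cⁿ` when `U` and `P` are. -/
theorem contDiff_rotHead {a α : ℝ} (J : E →L[ℝ] E) {U : E → E} {P : E → ℝ} {n : ℕ∞}
    (hU : ContDiff ℝ n U) (hP : ContDiff ℝ n P) :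
    ContDiff ℝ n fun y => headPressure a U P y - α * ⟪J y, U y⟫ :=
  (contDiff_headPressure hU hP).sub (contDiff_const.mul (J.contDiff.inner ℝ hU))

omit [FiniteDimensional ℝ E] in
/-- **Gradient of `Π_α`**: `DΠ_α(y) v = ⟪U, DU v⟫ + DP v + a(⟪v, U⟫ + ⟪y, DU v⟫) − α(⟪J y, DU v⟫ + ⟪J v, U⟫)`. -/
theorem fderiv_rotHead_apply {a α : ℝ} (J : E →L[ℝ] E) {U : E → E} {P : E → ℝ}
    (hU : Differentiable ℝ U) (hP : Differentiable ℝ P) (y v : E) :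
    fderiv ℝ (fun z => headPressure a U P z - α * ⟪J z, U z⟫) y v =
      ⟪U y, fderiv ℝ U y v⟫ + fderiv ℝ P y v + a * (⟪v, U y⟫ + ⟪y, fderiv ℝ U y v⟫) -
        α * (⟪J y, fderiv ℝ U y v⟫ + ⟪J v, U y⟫) := by
  have hA : DifferentiableAt ℝ (headPressure a U P) y := by
    have hfun : headPressure a U P = fun y => 2⁻¹ * ⟪U y, U y⟫ + P y + a * ⟪y, U y⟫ :=
      funext (headPressure_apply_inner a U P)
    rw [hfun]
    exact ((((hU y).inner ℝ (hU y)).const_mul _).add (hP y)).add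
      ((differentiableAt_fun_id.inner ℝ (hU y)).const_mul _)
  have hB' : DifferentiableAt ℝ (fun z => ⟪J z, U z⟫) y := J.differentiableAt.inner ℝ (hU y)
  have hB : DifferentiableAt ℝ (fun z => α * ⟪J z, U z⟫) y := hB'.const_mul α
  rw [fderiv_fun_sub hA hB, fderiv_const_mul hB', _root_.sub_apply, _root_.smul_apply, fderiv_headPressure_apply hU hP y v,
    fderiv_inner_clm_apply J (hU y) v, smul_eq_mul]

/-- **Laplacian of `Π_α`**: `ΔΠ_α = ⟪ΔU, U⟫ + |DU|² + ΔP + a(⟪y, ΔU⟫ + 2 div U) − α(⟪J y, ΔU⟫ − 2 tr(J ∘ DU))`. -/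
theorem laplacian_rotHead {a α : ℝ} {J : E →L[ℝ] E} (hJ : ∀ v w, ⟪J v, w⟫ = -⟪v, J w⟫)
    {U : E → E} {P : E → ℝ} (hU : ContDiff ℝ 2 U) (hP : ContDiff ℝ 2 P) (x : E) :
    (Δ fun y => headPressure a U P y - α * ⟪J y, U y⟫) x =
      ⟪(Δ U) x, U x⟫ + frobeniusNormSq (fderiv ℝ U x) + (Δ P) x +
        a * (⟪x, (Δ U) x⟫ + 2 * VectorCalculus.divergence U x) -
        α * (⟪J x, (Δ U) x⟫ - 2 * traceCLM (J.comp (fderiv ℝ U x))) := by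
  have hH : ContDiff ℝ 2 (headPressure a U P) := contDiff_headPressure hU hP
  have hI : ContDiff ℝ 2 fun y => ⟪J y, U y⟫ := J.contDiff.inner ℝ hU
  have hαI : ContDiff ℝ 2 (α • fun y => ⟪J y, U y⟫) := contDiff_const.smul hI
  have e : (fun y => headPressure a U P y - α * ⟪J y, U y⟫) =
      headPressure a U P - α • fun y => ⟪J y, U y⟫ := by
    funext y
    simp [smul_eq_mul]
  rw [e, hH.contDiffAt.laplacian_sub hαI.contDiffAt, laplacian_smul α hI.contDiffAt,
    laplacian_headPressure hU hP x, laplacian_inner_clm_eq hJ hU x, smul_eq_mul]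

/-- **The gradient identity** (rotated form of Tsai's (5.2) / NRŠ (2.9)): `∇Π_α = νΔU − (DU − DUᵀ)(U + a y − α J y)`
(on `ℝ³`: `∇Π_α = νΔU − Ω × (U + a y − α Jy)`); only the equation AT `y` and differentiability are used. -/
theorem fderiv_rotHead_eq {ν a α : ℝ} {J : E →L[ℝ] E} (hJ : ∀ v w, ⟪J v, w⟫ = -⟪v, J w⟫)
    {U : E → E} {P : E → ℝ} (hU : Differentiable ℝ U) (hP : Differentiable ℝ P) {y : E}
    (heq : -(ν • (Δ U) y) + a • U y + a • fderiv ℝ U y y + convect U U y + gradient P y +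
      α • (J (U y) - fderiv ℝ U y (J y)) = 0) (v : E) :
    fderiv ℝ (fun z => headPressure a U P z - α * ⟪J z, U z⟫) y v =
      ν * ⟪(Δ U) y, v⟫ - ⟪spin U y (U y + a • y - α • J y), v⟫ := by
  haveI : CompleteSpace E := FiniteDimensional.complete ℝ E
  have hDer := fderiv_rotHead_apply (a := a) (α := α) J hU hP y v
  have hEv : ⟪-(ν • (Δ U) y) + a • U y + a • fderiv ℝ U y y + convect U U y + gradient P y +
      α • (J (U y) - fderiv ℝ U y (J y)), v⟫ = 0 := by
    rw [heq, inner_zero_left]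
  simp only [inner_add_left, inner_sub_left, inner_neg_left, real_inner_smul_left, convect_apply, gradient,
    InnerProductSpace.toDual_symm_apply] at hEv
  have hspin : ⟪spin U y (U y + a • y - α • J y), v⟫ =
      ⟪fderiv ℝ U y (U y + a • y - α • J y), v⟫ - ⟪U y + a • y - α • J y, fderiv ℝ U y v⟫ := by
    rw [spin, _root_.sub_apply, inner_sub_left, ContinuousLinearMap.adjoint_inner_left]
  rw [hDer, hspin]
  simp only [map_add, map_sub, map_smul, inner_add_left, inner_sub_left, real_inner_smul_left]
  rw [real_inner_comm v (U y)] at hEv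
  have s : ⟪J v, U y⟫ = -⟪J (U y), v⟫ := by
    rw [hJ v (U y), real_inner_comm (J (U y)) v]
  linear_combination hEv - α * s

/-- **THE IDENTITY.**  For a rotated Leray profile (`U ∈ C³`, `P ∈ C²`, `div U = 0`, `J` skew,
`−νΔU + aU + a(y·∇)U + (U·∇)U + ∇P + α(JU − (Jy·∇)U) = 0`) the rotation-corrected head pressure
`Π_α = ½|U|² + P + a y·U − α (Jy)·U` satisfies `ν ΔΠ_α − DΠ_α[U + a y − α J y] = (ν/2)|DU − DUᵀ|² + 2να·tr(J ∘ DU)`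
(on `ℝ³`, `J = e₃×`: `tr(J∘DU) = −Ω₃`, so `−νΔΠ_α + (U + ay − αJy)·∇Π_α = −ν(|Ω|² − 2αΩ₃)`). -/
theorem driftOp_rotHead_eq {ν a α : ℝ} {J : E →L[ℝ] E} (hJ : ∀ v w, ⟪J v, w⟫ = -⟪v, J w⟫)
    {U : E → E} {P : E → ℝ} (hU3 : ContDiff ℝ 3 U) (hP2 : ContDiff ℝ 2 P)
    (hdiv : VectorCalculus.IsDivFree U)
    (heq : ∀ y, -(ν • (Δ U) y) + a • U y + a • fderiv ℝ U y y + convect U U y + gradient P y +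
      α • (J (U y) - fderiv ℝ U y (J y)) = 0) (y : E) :
    driftOp ν a (fun z => U z - α • J z) (fun z => headPressure a U P z - α * ⟪J z, U z⟫) y =
      ν / 2 * frobeniusNormSq (spin U y) + 2 * ν * α * traceCLM (J.comp (fderiv ℝ U y)) := by
  haveI : CompleteSpace E := FiniteDimensional.complete ℝ E
  have hU2 : ContDiff ℝ 2 U := hU3.of_le (by norm_num)
  have hU1 : ContDiff ℝ 1 U := hU3.of_le (by norm_num)
  have hUd : Differentiable ℝ U := hU1.differentiable one_ne_zero
  have hPd : Differentiable ℝ P := (hP2.of_le one_le_two).differentiable one_ne_zero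
  have hΔP := laplacian_pressure_eq_rot hU3 hP2 hdiv heq y
  have hLap := laplacian_rotHead (a := a) (α := α) hJ hU2 hP2 y
  have hw : U y - α • J y + a • y = U y + a • y - α • J y := by abel
  have hgrad := fderiv_rotHead_eq hJ hUd hPd (heq y) (U y + a • y - α • J y)
  have hanti : ⟪spin U y (U y + a • y - α • J y), U y + a • y - α • J y⟫ = 0 := by
    rw [spin, _root_.sub_apply, inner_sub_left, ContinuousLinearMap.adjoint_inner_left]
    exact sub_eq_zero.2 (real_inner_comm _ _)
  have hspin : frobeniusNormSq (spin U y) =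
      2 * (frobeniusNormSq (fderiv ℝ U y) - traceCLM ((fderiv ℝ U y).comp (fderiv ℝ U y))) :=
    frobeniusNormSq_sub_adjoint _
  unfold driftOp
  beta_reduce
  rw [hw, hgrad, hanti, sub_zero, hLap, hΔP, hdiv y, hspin]
  simp only [inner_add_right, inner_sub_right, real_inner_smul_right]
  set L : E := (Δ U : E → E) y with hL
  have c1 : ⟪y, L⟫ = ⟪L, y⟫ := real_inner_comm L y
  have c2 : ⟪J y, L⟫ = ⟪L, J y⟫ := real_inner_comm L (J y)
  rw [c1, c2]
  ring

/-- **Subsolution.**  If `ν ≥ 0` and `α·tr(J∘DU(y)) ≥ 0` (on `ℝ³`, `J = e₃×`: `α ω₃(y) ≤ 0`, rotation OPPOSITE to the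
one-signed vertical vorticity) then `ν ΔΠ_α − (U + a y − αJy)·∇Π_α ≥ 0` at `y` (hypothesis of Tsai's Lemma 5.1). -/
theorem driftOp_rotHead_nonneg {ν a α : ℝ} {J : E →L[ℝ] E} (hJ : ∀ v w, ⟪J v, w⟫ = -⟪v, J w⟫)
    {U : E → E} {P : E → ℝ} (hU3 : ContDiff ℝ 3 U) (hP2 : ContDiff ℝ 2 P)
    (hdiv : VectorCalculus.IsDivFree U)
    (heq : ∀ y, -(ν • (Δ U) y) + a • U y + a • fderiv ℝ U y y + convect U U y + gradient P y +
      α • (J (U y) - fderiv ℝ U y (J y)) = 0) (hν : 0 ≤ ν) {y : E}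
    (hsign : 0 ≤ α * traceCLM (J.comp (fderiv ℝ U y))) :
    0 ≤ driftOp ν a (fun z => U z - α • J z) (fun z => headPressure a U P z - α * ⟪J z, U z⟫) y := by
  rw [driftOp_rotHead_eq hJ hU3 hP2 hdiv heq y]
  have h1 : 0 ≤ frobeniusNormSq (spin U y) := frobeniusNormSq_nonneg _
  have h2 : 0 ≤ ν * (α * traceCLM (J.comp (fderiv ℝ U y))) := mul_nonneg hν hsign
  nlinarith

/-- **Constancy of `Π_α` forces `DU = DUᵀ` and `ΔU ≡ 0`** (rotated form of the end of Tsai's proof of his Theorem 1,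
p. 48), provided `ν > 0` and `α·tr(J∘DU) ≥ 0` everywhere. -/
theorem spin_eq_zero_and_laplacian_eq_zero_of_rotHead_const {ν a α : ℝ} {J : E →L[ℝ] E}
    (hJ : ∀ v w, ⟪J v, w⟫ = -⟪v, J w⟫) {U : E → E} {P : E → ℝ} (hU3 : ContDiff ℝ 3 U)
    (hP2 : ContDiff ℝ 2 P) (hdiv : VectorCalculus.IsDivFree U)
    (heq : ∀ y, -(ν • (Δ U) y) + a • U y + a • fderiv ℝ U y y + convect U U y + gradient P y +
      α • (J (U y) - fderiv ℝ U y (J y)) = 0) (hν : 0 < ν)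
    (hsign : ∀ y, 0 ≤ α * traceCLM (J.comp (fderiv ℝ U y)))
    (hconst : ∀ x y, headPressure a U P x - α * ⟪J x, U x⟫ = headPressure a U P y - α * ⟪J y, U y⟫)
    (y : E) : spin U y = 0 ∧ (Δ U) y = 0 := by
  haveI : CompleteSpace E := FiniteDimensional.complete ℝ E
  have hU1 : ContDiff ℝ 1 U := hU3.of_le (by norm_num)
  have hUd : Differentiable ℝ U := hU1.differentiable one_ne_zero
  have hPd : Differentiable ℝ P := (hP2.of_le one_le_two).differentiable one_ne_zero
  have hfun : (fun z => headPressure a U P z - α * ⟪J z, U z⟫) =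
      fun _ => headPressure a U P 0 - α * ⟪J 0, U 0⟫ := funext fun x => hconst x 0
  have hD0 : ∀ w, fderiv ℝ (fun z => headPressure a U P z - α * ⟪J z, U z⟫) y w = 0 := fun w => by
    rw [hfun]
    simp
  have hΔ0 : (Δ fun z => headPressure a U P z - α * ⟪J z, U z⟫) y = 0 := by
    rw [hfun]
    exact laplacian_const_eq_zero _ _
  have hdrift : driftOp ν a (fun z => U z - α • J z) (fun z => headPressure a U P z - α * ⟪J z, U z⟫) y = 0 := by
    unfold driftOp
    rw [hΔ0, hD0, mul_zero, sub_zero]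
  have hid := driftOp_rotHead_eq hJ hU3 hP2 hdiv heq y
  rw [hdrift] at hid
  have h1 : 0 ≤ frobeniusNormSq (spin U y) := frobeniusNormSq_nonneg _
  have h2 : 0 ≤ α * traceCLM (J.comp (fderiv ℝ U y)) := hsign y
  have hF : frobeniusNormSq (spin U y) = 0 := by nlinarith
  have hspin : spin U y = 0 := eq_zero_of_frobeniusNormSq_eq_zero hF
  refine ⟨hspin, ?_⟩
  -- the gradient identity tested against `ΔU(y)`
  have hg := fderiv_rotHead_eq hJ hUd hPd (heq y) ((Δ U) y)
  rw [hD0, hspin, _root_.zero_apply, inner_zero_left, sub_zero] at hg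
  have hLL : ⟪(Δ U) y, (Δ U) y⟫ = 0 := by
    have := hg.symm
    rcases mul_eq_zero.1 this with h | h
    · exact absurd h hν.ne'
    · exact h
  exact inner_self_eq_zero.1 hLL

/-! ### `ℝ³`, `J = e₃ ×` (`rotGenL`): the defect is exactly `2αω₃` -/

section R3

/-- The generator `J v = e₃ × v = (−v₁, v₀, 0)` of the rotations about the vertical axis (`rotGenL`) is skew. -/
theorem rotGenL_skew (v w : EuclideanSpace ℝ (Fin 3)) : ⟪rotGenL v, w⟫ = -⟪v, rotGenL w⟫ := by
  rw [rotGenL_apply, rotGenL_apply]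
  exact inner_rotGen_left_eq_neg v w

/-- `tr (J ∘ L) = −(L e₀ · e₁ − L e₁ · e₀)` for `J = e₃ ×`. -/
theorem traceCLM_rotGenL_comp (L : EuclideanSpace ℝ (Fin 3) →L[ℝ] EuclideanSpace ℝ (Fin 3)) :
    traceCLM (rotGenL.comp L) = -(L (EuclideanSpace.single 0 1) 1 - L (EuclideanSpace.single 1 1) 0) := by
  rw [traceCLM_eq_sum_inner (EuclideanSpace.basisFun (Fin 3) ℝ)]
  simp only [Fin.sum_univ_three, EuclideanSpace.basisFun_apply, ContinuousLinearMap.comp_apply, rotGenL_apply,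
    EuclideanSpace.inner_single_left, map_one, one_mul, rotGen_apply_zero, rotGen_apply_one, rotGen_apply_two]
  ring

/-- **`tr (J ∘ DU) = −ω₃`** for `J = e₃ ×` (the trace term of `driftOp_rotHead_eq`; `(curl U)₂ = ∂₀U₁ − ∂₁U₀`). -/
theorem traceCLM_rotGenL_comp_fderiv (U : EuclideanSpace ℝ (Fin 3) → EuclideanSpace ℝ (Fin 3)) (y : EuclideanSpace ℝ (Fin 3)) :
    traceCLM (rotGenL.comp (fderiv ℝ U y)) = -(curl U y 2) := by
  rw [traceCLM_rotGenL_comp, curl_apply_two]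

/-- **The identity on `ℝ³`** (`J = e₃ ×`): `ν ΔΠ_α − (U + a y − α e₃×y)·∇Π_α = ν (|curl U|² − 2α (curl U)₂)` —
the defect of the maximum principle for the rotation-corrected Bernoulli function is EXACTLY `2α ω₃`. -/
theorem driftOp_rotHead_eq_R3 {ν a α : ℝ} {U : EuclideanSpace ℝ (Fin 3) → EuclideanSpace ℝ (Fin 3)}
    {P : EuclideanSpace ℝ (Fin 3) → ℝ} (hU3 : ContDiff ℝ 3 U)
    (hP2 : ContDiff ℝ 2 P) (hdiv : VectorCalculus.IsDivFree U)
    (heq : ∀ y, -(ν • (Δ U) y) + a • U y + a • fderiv ℝ U y y + convect U U y + gradient P y +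
      α • (rotGenL (U y) - fderiv ℝ U y (rotGenL y)) = 0) (y : EuclideanSpace ℝ (Fin 3)) :
    driftOp ν a (fun z => U z - α • rotGenL z) (fun z => headPressure a U P z - α * ⟪rotGenL z, U z⟫) y =
      ν * (‖curl U y‖ ^ 2 - 2 * α * curl U y 2) := by
  have hU1 : ContDiff ℝ 1 U := hU3.of_le (by norm_num)
  have hUd : Differentiable ℝ U := hU1.differentiable one_ne_zero
  rw [driftOp_rotHead_eq rotGenL_skew hU3 hP2 hdiv heq y, traceCLM_rotGenL_comp_fderiv,
    norm_curl_sq_eq_frobeniusNormSq_spin_holds U y (hUd y)]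
  ring

/-- **Closed hemisphere + counter-rotation ⇒ subsolution.**  If `ν ≥ 0`, the vertical vorticity is one-signed,
`(curl U)₂ ≥ 0` (the closed-hemisphere condition of the door), and `α ≤ 0`, then `Π_α` is a subsolution of Tsai's
drift–Laplace operator on all of `ℝ³`. -/
theorem driftOp_rotHead_nonneg_R3 {ν a α : ℝ} {U : EuclideanSpace ℝ (Fin 3) → EuclideanSpace ℝ (Fin 3)}
    {P : EuclideanSpace ℝ (Fin 3) → ℝ} (hU3 : ContDiff ℝ 3 U)
    (hP2 : ContDiff ℝ 2 P) (hdiv : VectorCalculus.IsDivFree U)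
    (heq : ∀ y, -(ν • (Δ U) y) + a • U y + a • fderiv ℝ U y y + convect U U y + gradient P y +
      α • (rotGenL (U y) - fderiv ℝ U y (rotGenL y)) = 0) (hν : 0 ≤ ν) (hα : α ≤ 0)
    (hsign : ∀ y, 0 ≤ curl U y 2) (y : EuclideanSpace ℝ (Fin 3)) :
    0 ≤ driftOp ν a (fun z => U z - α • rotGenL z) (fun z => headPressure a U P z - α * ⟪rotGenL z, U z⟫) y := by
  refine driftOp_rotHead_nonneg rotGenL_skew hU3 hP2 hdiv heq hν ?_
  rw [traceCLM_rotGenL_comp_fderiv, mul_neg]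
  exact neg_nonneg.2 (mul_nonpos_of_nonpos_of_nonneg hα (hsign y))

end R3

end Summit.NavierStokesRegularity.NavierStokesRegularity.Theorems.HalfSpaceWindowDoorCirculationCarryingRigidityRotHead

end
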